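import Summits.ValiantsHypothesis.ValiantsHypothesis.Theses.LacunarySymmetroid
import Summits.ValiantsHypothesis.ValiantsHypothesis.Theorems.LacunarySymmetroidMatrixDescartesCensusRealExponentsDoors
import Summits.ValiantsHypothesis.ValiantsHypothesis.Theorems.LacunarySymmetroidMatrixDescartesCensusRealExponentsAllSizes

/-!
# Crux `DoorA26` — line «inverse-door» (ideator val-idea-4 g2; NEGATION FACE of line «extremal-inverse»; INSTRUMENT LINE)

D-0145 LINE: three `sorry`s, exactly the stubs `stub_prescribedToPencil` (support, M), `stub_witness20` (THE BET of this face,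
search target), `stub_witness19` (the OPEN REGISTER `ζ_sym(2,6) ≥ 19`), and TWO kernel-checked compositions: `not_DoorA26_of :
… → ¬ DoorA26` (concludes the NEGATION of the crux decl by name — «¬S is just another statement») and `not_posRootLawAt_2_6_18_of :
… → ¬ PosRootLawAt 2 6 18` (the register).  Nothing here bears on `MatrixDescartes` / Conjecture B or on VP ≠ VNP; it is the
`(2,6)` door of the `(2,K)` column only, refutation side.

STRATEGY.  PRESCRIBE THE ROOTS, SOLVE FOR THE GRAM.  A `(2,6)` symmetric pencil over REAL exponents `δ` (legitimate unknowns by the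
in-tree transfer `Census.RealExp.theses_doorA26_iff_rpow` / `not_posRootLawAt_iff_all`) has `det (Σ_l x^{δ_l} S_l) = Σ_{i,j}
M_{ij} x^{δᵢ+δⱼ} =: gramFn δ M x` with `M = v vᵀ − u uᵀ − w wᵀ` (`IsSymmetroidGram`), and conversely every such `M ≠ 0` on a
Sidon `δ` IS a pencil with the same positive zero set (`stub_prescribedToPencil`; `a = v + u`, `c = v − u`, `b = w`).  For FIXED
roots `r` the conditions `gramFn δ M (r_a) = 0` are LINEAR in `M`: twenty prescribed roots on a Sidon support leave (generically)
a ONE-dimensional solution line `ℝ · M(r, δ)` in `Sym₆(ℝ) ≅ ℝ²¹` — the would-be Gram of line «extremal-inverse» — and nineteen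
leave a 2-plane.  So `¬ DoorA26` ⟺ «some would-be Gram `M(r, δ)` is a symmetroid Gram» and `ζ_sym(2,6) ≥ 19` ⟺ «some 2-plane of
19-root solutions contains a symmetroid Gram»: EXISTENCE statements with the pencil eliminated, whose unknowns `(r, δ)` live in
a connected open set and whose residual (distance of the equilibrated `M(r,δ)` to inertia `(1,2,3)`: `log₁₀(σ₄/σ₃)` + sign
pattern of the top three eigenvalues) is a smooth objective — the INSTRUMENT `inv/search.py` (mode `rank3`), calibrated at
`(2,4)` on `W₂₄` (all ten coefficients of `F₂₄` recovered as `−1/256 ×` the signed minors at its nine roots; Gram eigenvalues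
`(+0.7071, ≈1e−118, −1.65e−5, −0.7071)`) and validated at `(2,4)` by re-finding rank-3 inertia-(1,2) would-be Grams from random
starts in 4 of 5 runs (`log₁₀(σ₄/σ₃) ≤ −17.8` on real supports `(0,1,2.03,6.64)`, `(0,1,3.6,6.49)`, `(0,1,2.95,5.16)`,
`(0,1,3.82,7.21)`).  STATUS at `K = 6`: no valid hit (best `K = 5` run `−1.40` in 270 s, not converged; `K = 6` needs kit-scale
budget: protocol `python3 inv/search.py 6 <seed> 600 out.jsonl 300 120 rank3` × ≥ 200 seeds, then Newton polish in exact
arithmetic and the kernel certificate via `stub_prescribedToPencil` + `Census.RealExp.isOpen_twentyLocus_two_six` + `doorA26_iff_twentyLocus_empty` (openness ⇒ a rational/integer support nearby)).  The signature-law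
evidence of line «extremal-inverse» (0 of 3000 would-be Grams at `K = 6` have `n₊ ≤ 1`) says the 20-root target is probably
EMPTY — this line is the honest other face: whichever of `stub_witness20` / `stub_signatureLaw6` dies first decides the door's
direction of effort; `stub_witness19` is live either way (the desk's 228 supports never exceed 18; (T) predicts 20).
SAME-WALL: exact reformulation, zero slack; the content is the SEARCH SPACE (roots + real exponents, 24 real unknowns, linear
elimination of the 21 coefficients) replacing pencil space (18 unknowns + 6 discrete exponents, degree-40 root finding per trial,
chamber by chamber).  NOVELTY: LOW and declared — the would-be-Gram dictionary is the cell's (theory g3, C13 at `(2,4)`; engine-6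
Gram scans), the rpow transfer is in-tree; new here = the typed compositions to `¬ DoorA26` / `¬ PosRootLawAt 2 6 18` with
prescribed roots as the primary unknowns, and the rank-3 residual objective with its `(2,4)` calibration numbers.
CHEAPEST FALSIFIER of `stub_witness20`: the signature law `stub_signatureLaw6` of line «extremal-inverse» (if proved, this stub
is FALSE and the line closes as the census of a dead direction); of `stub_witness19`: none cheap (a proof of `PosRootLawAt 2 6 18`
would contradict the desk's attained 18? no — 18 attained means `¬ PosRootLawAt 2 6 17`; `ζ = 18` exactly would kill it).
BEARS ON: stmt-ValiantsHypothesis-19979 (`DoorA26`, negation side), conjecture (T) (`DescartesExtremalThin` at `(2,6)`).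
-/

set_option linter.dupNamespace false
set_option autoImplicit false

namespace Summit.ValiantsHypothesis.ValiantsHypothesis.Cruxes.DoorA26.InverseDoor

open Matrix Finset
open scoped BigOperators
open Summit.ValiantsHypothesis.ValiantsHypothesis.Theses.LacunarySymmetroid (DoorA26)
open Summit.ValiantsHypothesis.ValiantsHypothesis.Theorems.MatrixDescartes.Negative (PosRootLawAt)
open Summit.ValiantsHypothesis.ValiantsHypothesis.Theorems.LacunarySymmetroidMatrixDescartes.Census.RealExp
  (theses_doorA26_iff_rpow not_posRootLawAt_iff_all)

/-- The quadratic-form fewnomial of a coefficient matrix on a REAL support: `x ↦ Σ_{i,j} M_{ij} x^{δᵢ+δⱼ}` (`x > 0`). -/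
noncomputable def gramFn (δ : Fin 6 → ℝ) (M : Matrix (Fin 6) (Fin 6) ℝ) (x : ℝ) : ℝ :=
  ∑ i, ∑ j, M i j * x ^ (δ i + δ j)

/-- Sidon (= `B₂`) support: all pair sums `δᵢ + δⱼ`, `i ≤ j`, distinct — the generic chamber condition (21 monomials). -/
def IsSidon (δ : Fin 6 → ℝ) : Prop :=
  ∀ i j k l : Fin 6, δ i + δ j = δ k + δ l → (i = k ∧ j = l) ∨ (i = l ∧ j = k)

/-- The symmetroid inertia `M = v vᵀ − u uᵀ − w wᵀ` (rank `≤ 3`, `n₊ ≤ 1`, `n₋ ≤ 2`): exactly the Gram matrices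
`½(a cᵀ + c aᵀ) − b bᵀ` of symmetric `2 × 2` pencils (`a = v + u`, `c = v − u`, `b = w`). -/
def IsSymmetroidGram (M : Matrix (Fin 6) (Fin 6) ℝ) : Prop :=
  ∃ v u w : Fin 6 → ℝ, M = Matrix.vecMulVec v v - Matrix.vecMulVec u u - Matrix.vecMulVec w w

/-- `n` prescribed positive roots of a nonzero symmetroid Gram on a Sidon real support. -/
def PrescribedWitness (n : ℕ) : Prop :=
  ∃ (δ : Fin 6 → ℝ) (M : Matrix (Fin 6) (Fin 6) ℝ) (r : Fin n → ℝ),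
    IsSidon δ ∧ IsSymmetroidGram M ∧ M ≠ 0 ∧ StrictMono r ∧ (∀ a, 0 < r a) ∧ ∀ a, gramFn δ M (r a) = 0

/-! ## Registered stubs -/

/-- **stub (support, size M): prescribed roots of a symmetroid Gram are pencil roots.**  From `M = v vᵀ − u uᵀ − w wᵀ ≠ 0`
build `S_l = !![v_l + u_l, w_l; w_l, v_l − u_l]`; then `det (Σ_l x^{δ_l} S_l) = gramFn δ M x` for `x > 0` (expand the `2 × 2`
determinant of the sum; the antisymmetric part of `a cᵀ` cancels in the double sum), the function `gramFn δ M` is a NONZERO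
real-exponent fewnomial on the Sidon support (distinct exponents `δᵢ + δⱼ`, `i ≤ j`, coefficients `M_{ii}`, `2 M_{ij}`), hence
has finitely many zeros on `(0,∞)` (`Literature.Computability.AlgebraicComplexity.BD17.satisfiesDescartesRule_rpow`, or
analyticity), so the positive zero set is finite, contains the `n` prescribed roots, and its `ncard` is `≥ n`. [folklore] -/
theorem stub_prescribedToPencil :
    ∀ n : ℕ, PrescribedWitness n →
      ∃ (δ : Fin 6 → ℝ) (S : Fin 6 → Matrix (Fin 2) (Fin 2) ℝ),
        (∀ l, (S l).IsSymm) ∧ n ≤ {x : ℝ | 0 < x ∧ (∑ l, (x ^ (δ l)) • S l).det = 0}.ncard := by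
  sorry

/-- **stub (THE BET of the negation face, size XL; a SEARCH TARGET): twenty prescribed roots.**  Some nonzero symmetroid Gram
on a Sidon real support vanishes at twenty prescribed points of `(0,∞)` — equivalently (line «extremal-inverse») some would-be
Gram `M(r, δ)` at `K = 6` has inertia `(1,2,3)`.  Why it might fail: `DoorA26` (the desk's 228 supports never exceed 18; the
signature-law samples of «extremal-inverse»: `n₊ ≤ 1` in 0 of 3000 would-be Grams).  How it would be proved: a kit-scale run of
`inv/search.py 6 … rank3` to residual `< 1e−30`, Newton polish of `(r, δ)` in 200-digit arithmetic onto the exact rank-3 locus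
(codimension 3 + sign conditions, 24 unknowns: positive-dimensional solution set if non-empty), rounding `δ` to rationals inside the
open twenty-locus (`Census.RealExp.isOpen_twentyLocus_two_six`, `doorA26_iff_twentyLocus_empty`), and a Sturm certificate in the kernel as for
`W₂₄`.  Sources: conjecture (T) of the cell (`DescartesExtremalThin`); `Census.RealExp.doorA26_iff_twentyLocus_empty`. -/
theorem stub_witness20 : PrescribedWitness 20 := by
  sorry

/-- **stub (the OPEN REGISTER `ζ_sym(2,6) ≥ 19`, size L; a SEARCH TARGET): nineteen prescribed roots.**  Same with nineteen
points: the 19-root solution space is (generically) a 2-PLANE of symmetric matrices, and the claim is that some such plane meets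
the symmetroid locus (rank 3, inertia (1,2)) — one dimension cheaper than `stub_witness20` and consistent with BOTH `DoorA26` and
(T).  Why it might fail: `ζ_sym(2,6) = 18` exactly (the desk value; no format with `ζ < D − 1` is known, but none is excluded).
Sources: desk CENSUS (`(2,6)`: 18 attained, `{18,19,20}` open); `Census.RealExp.not_posRootLawAt_iff_all`. -/
theorem stub_witness19 : PrescribedWitness 19 := by
  sorry

/-! ## Compositions (kernel-checked, no `sorry`) -/

/-- **`¬ DoorA26` from the two stubs of the negation face** (real-exponent transfer in-tree). -/
theorem not_DoorA26_of (hW : PrescribedWitness 20)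
    (hP : ∀ n : ℕ, PrescribedWitness n →
      ∃ (δ : Fin 6 → ℝ) (S : Fin 6 → Matrix (Fin 2) (Fin 2) ℝ),
        (∀ l, (S l).IsSymm) ∧ n ≤ {x : ℝ | 0 < x ∧ (∑ l, (x ^ (δ l)) • S l).det = 0}.ncard) :
    ¬ DoorA26 := by
  intro hD
  obtain ⟨δ, S, hS, h20⟩ := hP 20 hW
  have h19 := (theses_doorA26_iff_rpow.mp hD) δ S hS
  omega

/-- **The register `ζ_sym(2,6) ≥ 19` from the nineteen-root stub.** -/
theorem not_posRootLawAt_2_6_18_of (hW : PrescribedWitness 19)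
    (hP : ∀ n : ℕ, PrescribedWitness n →
      ∃ (δ : Fin 6 → ℝ) (S : Fin 6 → Matrix (Fin 2) (Fin 2) ℝ),
        (∀ l, (S l).IsSymm) ∧ n ≤ {x : ℝ | 0 < x ∧ (∑ l, (x ^ (δ l)) • S l).det = 0}.ncard) :
    ¬ PosRootLawAt 2 6 18 := by
  obtain ⟨δ, S, hS, h19⟩ := hP 19 hW
  exact (not_posRootLawAt_iff_all 2 6 18).mpr ⟨δ, S, hS, h19⟩

/-- Monotonicity of the register statements (twenty prescribed roots give nineteen). -/
theorem prescribedWitness_mono {n k : ℕ} (h : k ≤ n) : PrescribedWitness n → PrescribedWitness k := by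
  rintro ⟨δ, M, r, hδ, hM, hM0, hr, hpos, hzero⟩
  refine ⟨δ, M, fun a => r (Fin.castLE h a), hδ, hM, hM0, ?_, fun a => hpos _, fun a => hzero _⟩
  intro a b hab
  apply hr
  rw [Fin.lt_def] at hab ⊢
  simpa using hab

/-- Layer invariants: the negation of the door and the register rest on exactly the registered `sorry`s. -/
theorem not_DoorA26_skeleton : ¬ DoorA26 := not_DoorA26_of stub_witness20 stub_prescribedToPencil

theorem not_posRootLawAt_2_6_18_skeleton : ¬ PosRootLawAt 2 6 18 :=
  not_posRootLawAt_2_6_18_of stub_witness19 stub_prescribedToPencil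

end Summit.ValiantsHypothesis.ValiantsHypothesis.Cruxes.DoorA26.InverseDoor
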